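import Literature.Analysis.FluidPDE.LerayHopf
import HarnessLib

/-!
# Barrier: non-uniqueness of Leray–Hopf solutions of the FORCED Navier–Stokes equations on the
# periodic box (Albritton–Brué–Colombo 2023, gluing)

Barrier catalogue entry for `NavierStokesRegularity` (D-0021), the PERIODIC companion of
`Literature.Barriers.NavierStokesRegularity.ForcedLerayHopfNonuniquenessNarrow`
(`ForcedLerayHopfNonuniqueness.lean`: Albritton–Brué–Colombo 2022, `ℝ³`), whose audit records the
periodic / bounded-domain extension only in prose (scope_caveats (b): "bounded domains / `𝕋³` are
printed elsewhere [AlbrittonBrueColombo2023Gluing, Thm. 1.1]"). This file vendors that printed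
extension, in its `𝕋³` case, as ONE named fact `ForcedLerayHopfNonuniquenessTorus` over the
accepted torus Leray–Hopf vocabulary (`Literature.Analysis.FluidPDE.Torus.IsLerayHopfOn`,
`LerayHopf.lean`), with the force in the faithful Bochner class (jointly measurable AND
`L¹(0,T; L²(𝕋³))`) exactly as the `ℝ³` audit required, and proves the one-line reformulation
`ForcedLerayHopfNonuniquenessTorus.not_uniqueness`.

## What is printed (D. Albritton, E. Brué, M. Colombo, *Gluing non-unique Navier–Stokes solutions*,
## Ann. PDE 9 (2023), no. 2, Paper 17 = arXiv:2209.03530)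

* **Thm. 1.1** (Non-uniqueness in bounded domains; §1, p. 3): "Let `Ω` be a smooth, bounded domain
  in `ℝ³` or the torus `𝕋³`. There exist `T > 0`, `f ∈ L¹_t L²_x(Ω × (0,T))`, and two distinct
  suitable Leray–Hopf solutions `u`, `ū` to the Navier–Stokes equations on `Ω × (0,T)` with body
  force `f`, initial condition `u₀ ≡ 0`, and no-slip boundary condition." Here
  `𝕋³ := ℝ³/(2πℤ)³` (§1 before Thm. 1.1; §2.4), viscosity `1` (the similarity variables (1.5)–(1.8)
  of the 2022 paper), and the boundary condition is vacuous on `𝕋³` (§2, after (2.1)).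
* Mechanism (§1, §1.1–1.2, §3–§6): `f` and `ū = t^{-1/2}Ū(x/√t)` (`Ū ∈ C₀^∞(B₁)`) are EXACTLY the
  self-similar force and solution of the 2022 paper, compactly supported inside `Ω ∋ 0`; the second
  solution is `u = ū + φη + ψ`, an inner correction `φ` at the self-similar scale `|x| ∼ t^{1/2}`
  glued through a cut-off `η(x,t) = η₀(x/t^γ)`, `0 < γ ≪ 1`, to an outer correction `ψ` solving a
  Stokes-type problem in `Ω` (parabolic inner–outer gluing after Dávila–del Pino–Wei); §6:
  `u ≠ ū` because `‖Φ^{lin}N(·,τ)‖_{L^p} ≳ e^{τa}` dominates the corrections as `τ → −∞`; both are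
  Leray–Hopf with right-hand side `f` (energy equality on `Ω × (ε, t̄)` for every `ε > 0`,
  `‖u(·,t_k)‖_{L²} → 0`).
* §1 (last paragraph): expected extensions — `k` gluing points; gluing the conditional Jia–Šverák
  solutions; gluing Vishik's 2D Euler non-uniqueness — "We leave these and other extensions to
  future work" (NOT proved).

## Rendering (unit torus; WEAKER than print)

* The tree's torus is `UnitAddTorus (Fin 3) = (ℝ/ℤ)³`; the printed solutions on `(ℝ/2πℤ)³ × (0,T)`
  are transported by the Navier–Stokes scaling `v(s,y) = 2π u(4π²s, 2πy)`,
  `g(s,y) = 8π³ f(4π²s, 2πy)`, which keeps `ν = 1`, the zero datum, the Leray–Hopf property and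
  `g ∈ L¹_s L²_y`, with `T ↦ T/(4π²)`.
* Leray–Hopf: the accepted `Literature.Analysis.FluidPDE.Torus.IsLerayHopfOn T 1 f 0 ·`
  (forced weak solution with datum, `L^∞_tL²_x ∩ L²_tH¹_x`, energy inequalities from `0` and from
  a.e. `s`, weak `L²`-continuity, strong attainment of the datum). "Suitable" (local energy
  inequality) is printed but NOT recorded (weaker).
* Force class: Def. 1.1 of the 2022 paper / Thm. 1.1 here take `f ∈ L¹_t L²_x(Ω × (0,T))`, a
  Bochner space on the slab; as in the `ℝ³` audit (refuter barrier audit 2026-08-16,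
  `Literature.Analysis.FluidPDE.ABCVacuity.rendering_is_vacuous`) the slice-wise class
  `Torus.MemLqLp 1 2 f (Ioo 0 T)` ALONE would let a non-measurable junk force make the weak
  identity's pairing `∫∫⟪f, ψ⟫` vanish, so the fact carries BOTH joint (a.e.-strong) measurability
  of the space–time lift `Torus.stLift f` on `(0,T) × ℝ³` and `Torus.MemLqLp 1 2 f (Ioo 0 T)`.
* "Distinct": the printed solutions are distinct elements of `L^∞_tL²_x`; since both are jointly
  measurable (first conjunct of `Torus.IsWeakNSSolutionForcedOn`), Fubini gives a time
  `t ∈ (0,T)` at which the slices are not a.e. equal — the clause recorded here (as in clause (iv)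
  of `ForcedLerayHopfNonuniquenessNarrow`).

## What is NOT here

The bounded-domain case with no-slip condition (no accepted vocabulary for Leray–Hopf solutions
in domains with boundary); suitability; the structure `u = ū + φη + ψ` and the self-similar form of
`f`; other viscosities (on a FIXED torus `v(t,x) = νu(νt,x)` solves the `ν`-problem with force
`ν²f(νt,x)` — not threaded); the announced-only extensions of §1.

## References

* D. Albritton, E. Brué, M. Colombo, *Gluing non-unique Navier–Stokes solutions*, Ann. PDE 9
  (2023), Paper No. 17 = arXiv:2209.03530, Thm. 1.1, §1, §2, §2.4, §6. [`AlbrittonBrueColombo2023Gluing`]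
* D. Albritton, E. Brué, M. Colombo, Ann. of Math. 196 (2022), 415–455, Def. 1.1, Thm. 1.2,
  Thm. 1.3. [`AlbrittonBrueColombo2022AnnMath`]
* C. Fefferman, *Existence and smoothness of the Navier–Stokes equation* (Clay, 2000/2006),
  statements (B), (D), hypotheses (8)–(11). [`Fefferman2000`]
* T. Buckmaster, V. Vicol, Ann. of Math. 189 (2019), Thm. 1.2. [`BuckmasterVicol2019AnnMath`]
* P. G. Lemarié-Rieusset, *The Navier–Stokes Problem in the 21st Century*, CRC 2016, Thm. 12.4,
  Prop. 12.3–12.4. [`LemarieRieusset2016`]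
-/

noncomputable section

open MeasureTheory Set Filter

namespace Literature.Barriers.NavierStokesRegularity

open Literature.Analysis.FluidPDE Literature.Analysis.FunctionSpaces

/-- **Barrier (Albritton–Brué–Colombo 2023, Thm. 1.1, periodic case): Leray–Hopf solutions of
the forced Navier–Stokes equations on the periodic box are not unique — unit-torus rendering,
weaker than print (module docstring).** There are `T > 0`, a body force `f` on
`(0,T) × 𝕋³`, `𝕋³ = (ℝ/ℤ)³`, whose space–time lift is jointly (a.e.-strongly) measurable and
which lies in `L¹(0,T; L²(𝕋³))` (together: the Bochner class `L¹_t L²_x` of the printed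
theorem), and two Leray–Hopf weak solutions `u`, `v` (accepted torus sense
`Literature.Analysis.FluidPDE.Torus.IsLerayHopfOn T 1 f 0 ·`, viscosity `1`) from the ZERO
datum whose slices at some time `t ∈ (0,T)` are not a.e. equal. Printed moreover, not recorded:
both are suitable; `f = t^{-3/2}F̄(x/√t)` and `ū = t^{-1/2}Ū(x/√t)` are the compactly supported
self-similar force and solution of Albritton–Brué–Colombo 2022, the second solution is
`ū + φη + ψ` (inner–outer gluing); the same holds in every smooth bounded domain `Ω ⊂ ℝ³` with
no-slip condition. [cite: AlbrittonBrueColombo2023Gluing, Thm. 1.1 (case Ω = 𝕋³) with §2.4 and §6]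

BARRIER (structured block, D-0021):
technique_class: leray-hopf-class leray-hopf-uniqueness energy-inequality weak-solution-uniqueness uniqueness-in-energy-class periodic-navier-stokes forced-periodic-wellposedness suitable-weak-solutions
blocks: every uniqueness principle for Leray–Hopf weak solutions of the FORCED Navier–Stokes system on the periodic box `𝕋³` (and, in print, on smooth bounded domains with no-slip condition) whose hypotheses are met by: zero datum, a jointly measurable force in `L¹_t L²_x` (indeed the self-similar `t^{-3/2}F̄(x/√t)`, `F̄ ∈ C_c^∞`, hence in `L^a_t L^b_x` for all `2/a + 3/b > 3`), suitable solutions — in particular any "energy-class well-posedness" strengthening of the periodic forced Clay problem (D)/(B) that tolerates `L¹_t L²_x` forces; in-tree reformulation `ForcedLerayHopfNonuniquenessTorus.not_uniqueness` [cite: AlbrittonBrueColombo2023Gluing, Thm. 1.1] [cite: AlbrittonBrueColombo2022AnnMath, Thm. 1.2 and Def. 1.1]; this is the locality/robustness statement: the `ℝ³` non-uniqueness of `ForcedLerayHopfNonuniquenessNarrow` survives confinement to any domain containing the space–time origin of the singular force [cite: AlbrittonBrueColombo2023Gluing, §1].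
because: the 2022 self-similar pair (`f̄`, `ū`) is compactly supported in `|x| ≲ √t`, so it sits inside `Ω`; the unstable-manifold solution `ū + u^{lin} + u^{per}` of the whole-space problem is replaced by the ansatz `u = ū + φη + ψ` — inner correction `φ` (similarity profile `Φ`, controlled by the linearised operator `L_ss` and the unstable eigenvalue `a = Re λ > 0` of the 2022 paper) truncated by `η(x,t) = η₀(x/t^γ)`, `0 < γ ≪ 1`, plus an outer correction `ψ` solving a Stokes-type system in `Ω` with the boundary (or periodicity) condition — the boundary terms carry derivatives of `η` and are small because `Φ` decays in weighted spaces (§2.2), so the inner/outer system decouples as `t → 0⁺` and is solved by a fixed point (§3–§5); `u ≠ ū` since `‖Φ^{lin}N(τ)‖_{L^p} ≳ e^{τa}` beats the corrections, and both are Leray–Hopf with force `f` (§6) [cite: AlbrittonBrueColombo2023Gluing, §1.1–1.2, §2.2, §3, §6].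
evasions_known: the same as for the whole-space entry: (1) one solution in a Prodi–Serrin / `C_tL³` / Kato-small class gives weak–strong uniqueness for the forced problem [cite: LemarieRieusset2016, Thm. 12.4 and Prop. 12.3] — the glued solutions leave every such class at `t = 0⁺`, where the force is scale-critically singular [cite: AlbrittonBrueColombo2022AnnMath, (1.13)–(1.14)]; (2) a SUBCRITICAL force, e.g. `f ∈ L^∞_t L^p_x`, `1 < p < 3` (Kozono–Sohr-type endpoint uniqueness) [cite: LemarieRieusset2016, Prop. 12.4 (b)]; (3) Clay-type data: the periodic Clay problems (B)/(D) require smooth `f` with decay in time [cite: Fefferman2000, statement (D) with hypotheses (8)–(11)] — for such forces Leray–Hopf uniqueness on the lifespan of the smooth solution is a theorem (local smooth solution + weak–strong uniqueness) and nothing printed bears on it; unforced periodic NON-Leray weak solutions are already non-unique [cite: BuckmasterVicol2019AnnMath, Thm. 1.2].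
scope_caveats: (a) unit viscosity and the UNIT torus (the printed `(ℝ/2πℤ)³` statement transported by the parabolic scaling, which preserves `ν = 1`, the zero datum and the force class); other viscosities follow on a fixed torus from `v(t,x) = νu(νt,x)` with force `ν²f(νt,·)` but are not threaded [cite: AlbrittonBrueColombo2023Gluing, §1 and §2.4]; (b) `u₀ = 0` only; non-zero data, `k ≥ 2` gluing points, the Jia–Šverák and Vishik variants are announced as expected, NOT proved [cite: AlbrittonBrueColombo2023Gluing, §1 (last paragraph)]; (c) suitability, the self-similar structure of `f` and `ū`, and the bounded-domain/no-slip case are printed but not recorded (no accepted vocabulary for Leray–Hopf solutions in domains with boundary) [cite: AlbrittonBrueColombo2023Gluing, Thm. 1.1]; (d) a statement about UNIQUENESS of weak solutions under a scale-critically singular force — nothing about regularity or blow-up from smooth data with smooth or zero force (Clay (A)–(D)).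
status: established -/
def ForcedLerayHopfNonuniquenessTorus : Prop :=
  ∃ T : ℝ, 0 < T ∧
    ∃ f : ℝ → UnitAddTorus (Fin 3) → EuclideanSpace ℝ (Fin 3),
      AEStronglyMeasurable (Torus.stLift f) (volume.restrict (Ioo 0 T ×ˢ univ)) ∧
      Literature.Analysis.FluidPDE.Torus.MemLqLp 1 2 f (Ioo 0 T) ∧
      ∃ u v : ℝ → UnitAddTorus (Fin 3) → EuclideanSpace ℝ (Fin 3),
        Literature.Analysis.FluidPDE.Torus.IsLerayHopfOn T 1 f 0 u ∧
        Literature.Analysis.FluidPDE.Torus.IsLerayHopfOn T 1 f 0 v ∧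
        ∃ t ∈ Ioo 0 T, ¬ (u t =ᵐ[volume] v t)

/-- **Reformulation as the failure of a uniqueness principle** (Albritton–Brué–Colombo 2023,
Thm. 1.1, periodic case): it is NOT the case that, for every `T > 0` and every jointly measurable
force `f ∈ L¹(0,T; L²(𝕋³))`, two Leray–Hopf solutions of the forced unit-viscosity system on
`𝕋³ × [0,T)` from the zero datum agree a.e. at every time `t ∈ (0,T)`. Proved from the barrier
fact. [cite: AlbrittonBrueColombo2023Gluing, Thm. 1.1] -/
theorem ForcedLerayHopfNonuniquenessTorus.not_uniqueness (h : ForcedLerayHopfNonuniquenessTorus) :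
    ¬ ∀ (T : ℝ) (f : ℝ → UnitAddTorus (Fin 3) → EuclideanSpace ℝ (Fin 3)), 0 < T →
        AEStronglyMeasurable (Torus.stLift f) (volume.restrict (Ioo 0 T ×ˢ univ)) →
        Literature.Analysis.FluidPDE.Torus.MemLqLp 1 2 f (Ioo 0 T) →
        ∀ u v : ℝ → UnitAddTorus (Fin 3) → EuclideanSpace ℝ (Fin 3),
          Literature.Analysis.FluidPDE.Torus.IsLerayHopfOn T 1 f 0 u →
          Literature.Analysis.FluidPDE.Torus.IsLerayHopfOn T 1 f 0 v →
          ∀ t ∈ Ioo 0 T, u t =ᵐ[volume] v t := by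
  intro hyp
  obtain ⟨T, hT, f, hf, hf1, u, v, hu, hv, t, ht, hne⟩ := h
  exact hne (hyp T f hT hf hf1 u v hu hv t ht)

/-- The periodic barrier gives the data of a counterexample to forced Leray–Hopf uniqueness at a
single positive time, in the shape consumed by energy-class well-posedness claims: a time `T`, a
Bochner-class force and two Leray–Hopf solutions from `0` that are not a.e. equal at some
`t ∈ (0,T)` (projection of the fact; Albritton–Brué–Colombo 2023, Thm. 1.1).
[cite: AlbrittonBrueColombo2023Gluing, Thm. 1.1] -/
theorem ForcedLerayHopfNonuniquenessTorus.exists_pair (h : ForcedLerayHopfNonuniquenessTorus) :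
    ∃ (T : ℝ) (f u v : ℝ → UnitAddTorus (Fin 3) → EuclideanSpace ℝ (Fin 3)),
      0 < T ∧ Literature.Analysis.FluidPDE.Torus.IsLerayHopfOn T 1 f 0 u ∧
        Literature.Analysis.FluidPDE.Torus.IsLerayHopfOn T 1 f 0 v ∧ ∃ t ∈ Ioo 0 T, ¬ (u t =ᵐ[volume] v t) := by
  obtain ⟨T, hT, f, -, -, u, v, hu, hv, t, ht, hne⟩ := h
  exact ⟨T, f, u, v, hT, hu, hv, t, ht, hne⟩

end Literature.Barriers.NavierStokesRegularity
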